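import Mathlib
import Summits.KontsevichZagierPeriods.Zeta5Search.Families.DualExactFullCone
import Summits.KontsevichZagierPeriods.Zeta5Search.Families.DualConstantTerm
import Summits.KontsevichZagierPeriods.Zeta5Search.Families.CoeffAsympTypes
import HarnessLib

/-!
# ζ(5) search — Families: CONJECTURE D on the genuine cone — the growth rate of Brown–Zudilin's leading coefficients IS
# the decay rate of the dual cellular family

HONEST FRAMING: systematic search; no irrationality claim unless certified.  Cell `pub-zeta5`, certifier 2
(cert-2 g9, 2026-08-22).  Real analysis of the coefficients of powers of a polynomial with non-negative integer
coefficients; nothing about the arithmetic of `ζ(5)`; no number of record moves.  No conjecture node is used as a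
hypothesis.

THE DICTIONARY between P2's dual ray (`Families/RayGrowth*`, `Families/DualConstantTerm`) and the abstract setting of
`Families/CoeffAsymp*`:
* `realPoly a` = `dualSpanProd (numExp a)` over `ℝ`, `baseExp a` = `gapExp a` as a monomial;
  `dualConstantTerm_ray_eq_coeff` — `dualConstantTerm (n·a) = [x^{n·B}] (realPoly a)ⁿ` on the cone `bzNum, bzDen ≥ 0`;
* `tilt_support_eq` — the abstract tilt of `realPoly a` at `u` is `Λ_a(e^u) = Λ-numerator(e^u)/e^{B·u}`;
* `simplexPoint` — the point of the open simplex with prescribed (normalised) gaps;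
* `rayF_dual_eq_inv` — on the open simplex the dual ray function `rayF ₈π₈ (bzDen a) (bzNum a)` is `1/Λ_a(gaps)`;
  `lam_smul` — `Λ_a` is invariant under scaling (Brown's homogeneity: `Σ A = Σ B`);
The identification `raySup = (inf Λ_a)⁻¹` and CONJECTURE D on the genuine cone follow in `Families/DualRateGenuine`.
Standard axioms only.
-/

noncomputable section

open MvPolynomial Finset Real Filter Topology

namespace Summit.KontsevichZagierPeriods.Zeta5Search.Families.Cellular

open Literature.NumberTheory.Irrationality CoeffAsymp DualCT

namespace DualRate

/-! ## The real polynomial and the base exponent -/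

/-- The dual span product of `a` as a real polynomial in the six gaps. -/
def realPoly (a : Fin 8 → ℤ) : MvPolynomial (Fin 6) ℝ :=
  MvPolynomial.map (Int.castRingHom ℝ) (dualSpanProd (numExp a))

/-- The base exponent `B = gapExp a` as a monomial. -/
def baseExp (a : Fin 8 → ℤ) : Fin 6 →₀ ℕ := Finsupp.equivFunOnFinite.symm (gapExp a)

/-- `baseExp a w = gapExp a w`. -/
@[simp] theorem baseExp_apply (a : Fin 8 → ℤ) (w : Fin 6) : baseExp a w = gapExp a w := by
  simp [baseExp]

/-- The coefficients of `realPoly a` are non-negative. -/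
theorem coeff_realPoly_nonneg (a : Fin 8 → ℤ) (m : Fin 6 →₀ ℕ) : 0 ≤ coeff m (realPoly a) := by
  unfold realPoly
  rw [coeff_map]
  exact (Int.cast_nonneg (coeff_dualSpanProd_nonneg (numExp a) m) :
    (0 : ℝ) ≤ ((coeff m (dualSpanProd (numExp a)) : ℤ) : ℝ))

/-- On its support the coefficients of `realPoly a` are positive. -/
theorem coeff_realPoly_pos (a : Fin 8 → ℤ) : ∀ m ∈ (realPoly a).support, 0 < coeff m (realPoly a) := fun m hm =>
  lt_of_le_of_ne (coeff_realPoly_nonneg a m) (Ne.symm (mem_support_iff.1 hm))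

/-- `realPoly a = poly (support) (coeff)`. -/
theorem realPoly_eq_poly (a : Fin 8 → ℤ) :
    realPoly a = poly (realPoly a).support (fun m => coeff m (realPoly a)) :=
  (realPoly a).as_sum

/-- The dual constant term in the abstract setting: `dualConstantTerm a = [x^B] realPoly a`. -/
theorem dualConstantTerm_eq_coeff (a : Fin 8 → ℤ) : (dualConstantTerm a : ℝ) = coeff (baseExp a) (realPoly a) := by
  unfold realPoly baseExp dualConstantTerm gapExp numExp
  rw [coeff_map]
  rfl

/-- **`dualConstantTerm (n·a) = [x^{n·B}] (realPoly a)ⁿ`** on the cone. -/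
theorem dualConstantTerm_ray_eq_coeff {a : Fin 8 → ℤ} (hA : ∀ i, 0 ≤ bzNum a i) (hB : ∀ i, 0 ≤ bzDen a i) (n : ℕ) :
    (dualConstantTerm (fun i => (n : ℤ) * a i) : ℝ) = coeff (n • baseExp a) (realPoly a ^ n) := by
  have h1 : dualConstantTerm (fun i => (n : ℤ) * a i) =
      coeff (Finsupp.equivFunOnFinite.symm (gapExp fun i => (n : ℤ) * a i))
        (dualSpanProd (numExp fun i => (n : ℤ) * a i)) := rfl
  rw [h1, numExp_smul n hA, gapExp_smul n hB, dualSpanProd_smul, realPoly, ← map_pow, coeff_map]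
  have h2 : (Finsupp.equivFunOnFinite.symm fun w => n * gapExp a w) = n • baseExp a := by
    ext w; simp [baseExp]
  rw [h2]
  rfl

/-- If `dualConstantTerm a ≠ 0` then `B` is in the support of `realPoly a`. -/
theorem baseExp_mem_support {a : Fin 8 → ℤ} (hct : dualConstantTerm a ≠ 0) : baseExp a ∈ (realPoly a).support := by
  rw [mem_support_iff, ← dualConstantTerm_eq_coeff]
  exact_mod_cast hct

/-! ## The Laurent polynomial `Λ_a` and the abstract tilt -/

/-- `Λ_a(g) = Λ-numerator(g) / g^B`. -/
def lam (a : Fin 8 → ℤ) (g : Fin 6 → ℝ) : ℝ := dualNumEval a g / ∏ w, g w ^ gapExp a w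

/-- **The abstract tilt of `realPoly a` is `Λ_a(e^u)`.** -/
theorem tilt_support_eq (a : Fin 8 → ℤ) (u : Fin 6 → ℝ) :
    tilt (realPoly a).support (fun m => coeff m (realPoly a)) (baseExp a) u = lam a (fun w => Real.exp (u w)) := by
  unfold tilt lam dualNumEval
  rw [eval₂_eq_eval_map, ← realPoly, MvPolynomial.eval_eq', Finset.sum_div]
  refine Finset.sum_congr rfl fun m _ => ?_
  rw [mul_div_assoc]
  congr 1
  have hpos : (0 : ℝ) < ∏ w, Real.exp (u w) ^ gapExp a w := Finset.prod_pos fun w _ => pow_pos (Real.exp_pos _) _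
  rw [eq_div_iff hpos.ne']
  have p1 : (∏ i, Real.exp (u i) ^ (m i : ℕ)) = Real.exp (∑ i, (m i : ℝ) * u i) := by
    rw [Real.exp_sum]; exact Finset.prod_congr rfl fun i _ => by rw [← Real.exp_nat_mul]
  have p2 : (∏ w, Real.exp (u w) ^ gapExp a w) = Real.exp (∑ w, (gapExp a w : ℝ) * u w) := by
    rw [Real.exp_sum]; exact Finset.prod_congr rfl fun w _ => by rw [← Real.exp_nat_mul]
  rw [p1, p2, ← Real.exp_add]
  congr 1
  unfold dot dvec
  rw [← Finset.sum_add_distrib]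
  exact Finset.sum_congr rfl fun i _ => by simp [baseExp_apply]; ring

/-- `Λ_a > 0` at positive points when `dualConstantTerm a ≠ 0`... more precisely `Λ_a(g) ≥ dualConstantTerm a` for
`g > 0`. -/
theorem dualConstantTerm_le_lam (a : Fin 8 → ℤ) {g : Fin 6 → ℝ} (hg : ∀ w, 0 < g w) :
    (dualConstantTerm a : ℝ) ≤ lam a g := by
  unfold lam
  rw [le_div_iff₀ (Finset.prod_pos fun w _ => pow_pos (hg w) _)]
  exact dualConstantTerm_mul_prod_le a g fun w => (hg w).le

/-! ## The explicit product form and homogeneity -/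

/-- `Λ-numerator(g)` as the explicit product of the six span powers. -/
theorem dualNumEval_eq (a : Fin 8 → ℤ) (g : Fin 6 → ℝ) : dualNumEval a g =
    (g 1 + g 2) ^ numExp a 0 * (g 1 + g 2 + g 3 + g 4 + g 5) ^ numExp a 1 * (g 2 + g 3 + g 4 + g 5) ^ numExp a 2 *
      (g 2 + g 3 + g 4) ^ numExp a 3 * (g 0 + g 1 + g 2 + g 3) ^ numExp a 6 * (g 0 + g 1 + g 2) ^ numExp a 7 := by
  simp [dualNumEval, dualSpanProd, eval₂_mul, eval₂_pow, eval₂_add, eval₂_X]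

/-- Brown's homogeneity on the cone: `Σ_{finite edges} A = Σ_{gaps} B`. -/
theorem sum_numExp_eq_sum_gapExp {a : Fin 8 → ℤ} (hA : ∀ i, 0 ≤ bzNum a i) (hB : ∀ i, 0 ≤ bzDen a i) :
    numExp a 0 + numExp a 1 + numExp a 2 + numExp a 3 + numExp a 6 + numExp a 7 = ∑ w, gapExp a w := by
  have hz : ((numExp a 0 + numExp a 1 + numExp a 2 + numExp a 3 + numExp a 6 + numExp a 7 : ℕ) : ℤ) =
      ((∑ w, gapExp a w : ℕ) : ℤ) := by
    rw [Fin.sum_univ_six]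
    push_cast
    simp only [numExp, gapExp]
    have e : ∀ i, ((bzNum a i).toNat : ℤ) = bzNum a i := fun i => Int.toNat_of_nonneg (hA i)
    have f : ∀ i, ((bzDen a i).toNat : ℤ) = bzDen a i := fun i => Int.toNat_of_nonneg (hB i)
    rw [e, e, e, e, e, e, f, f, f, f, f, f]
    simp [bzNum, bzDen, BrownZudilin2022.b24, BrownZudilin2022.b14, BrownZudilin2022.b57, BrownZudilin2022.b35,
      Fin.castLE]
    ring
  exact_mod_cast hz

/-- **Scale invariance** `Λ_a(s·g) = Λ_a(g)` for `s > 0` on the cone. -/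
theorem lam_smul {a : Fin 8 → ℤ} (hA : ∀ i, 0 ≤ bzNum a i) (hB : ∀ i, 0 ≤ bzDen a i) {s : ℝ} (hs : 0 < s)
    (g : Fin 6 → ℝ) : lam a (fun w => s * g w) = lam a g := by
  have hsum := sum_numExp_eq_sum_gapExp hA hB
  set N := ∑ w, gapExp a w with hN
  have hnum : dualNumEval a (fun w => s * g w) = s ^ N * dualNumEval a g := by
    rw [dualNumEval_eq, dualNumEval_eq, ← hsum]
    have e1 : s * g 1 + s * g 2 = s * (g 1 + g 2) := by ring
    have e2 : s * g 1 + s * g 2 + s * g 3 + s * g 4 + s * g 5 = s * (g 1 + g 2 + g 3 + g 4 + g 5) := by ring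
    have e3 : s * g 2 + s * g 3 + s * g 4 + s * g 5 = s * (g 2 + g 3 + g 4 + g 5) := by ring
    have e4 : s * g 2 + s * g 3 + s * g 4 = s * (g 2 + g 3 + g 4) := by ring
    have e5 : s * g 0 + s * g 1 + s * g 2 + s * g 3 = s * (g 0 + g 1 + g 2 + g 3) := by ring
    have e6 : s * g 0 + s * g 1 + s * g 2 = s * (g 0 + g 1 + g 2) := by ring
    rw [e2, e3, e5, e1, e4, e6]
    simp only [mul_pow, pow_add]
    ring
  have hden : (∏ w, (s * g w) ^ gapExp a w) = s ^ N * ∏ w, g w ^ gapExp a w := by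
    simp only [mul_pow, Finset.prod_mul_distrib, Finset.prod_pow_eq_pow_sum, hN]
  unfold lam
  rw [hnum, hden, mul_div_mul_left _ _ (pow_pos hs N).ne']

/-! ## The dual ray function on the simplex -/

/-- The gaps of a point of the simplex: `g_w = pt t (w+1) − pt t w`. -/
def gap (t : Fin 5 → ℝ) (w : Fin 6) : ℝ := pt t (w.val + 1) - pt t w.val

/-- The gaps are positive on the open simplex. -/
theorem gap_pos {t : Fin 5 → ℝ} (ht : t ∈ openSimplex 5) (w : Fin 6) : 0 < gap t w := by
  have h := ht ⟨w.val, by omega⟩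
  unfold gap
  have : ((⟨w.val, by omega⟩ : Fin 6) + 1 : Fin 6).val = w.val + 1 ∨ w.val = 5 := by
    fin_cases w <;> simp
  fin_cases w <;> simp [pt] at h ⊢ <;> linarith

/-- The dual ray function in zpow form. -/
theorem rayF_dual_zpow (a : Fin 8 → ℤ) (t : Fin 5 → ℝ) : rayF pi8dualInv (bzDen a) (bzNum a) t =
    (t 0 ^ bzDen a 0 * (t 1 - t 0) ^ bzDen a 1 * (t 2 - t 1) ^ bzDen a 2 * (t 3 - t 2) ^ bzDen a 3 *
        (t 4 - t 3) ^ bzDen a 4 * (1 - t 4) ^ bzDen a 5) /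
      ((t 2 - t 0) ^ bzNum a 0 * (1 - t 0) ^ bzNum a 1 * (1 - t 1) ^ bzNum a 2 * (t 4 - t 1) ^ bzNum a 3 *
        t 3 ^ bzNum a 6 * t 2 ^ bzNum a 7) := by
  simp [rayF, num, den, Fin.prod_univ_eight, pi8dualInv, ef, pt, max_def, min_def, bzNum, bzDen]

/-- **On the open simplex the dual ray function is `1/Λ_a(gaps)`** (cone `bzNum, bzDen ≥ 0`). -/
theorem rayF_dual_eq_inv {a : Fin 8 → ℤ} (hA : ∀ i, 0 ≤ bzNum a i) (hB : ∀ i, 0 ≤ bzDen a i) (t : Fin 5 → ℝ) :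
    rayF pi8dualInv (bzDen a) (bzNum a) t = (lam a (gap t))⁻¹ := by
  rw [rayF_dual_zpow, lam, inv_div, dualNumEval_eq, Fin.prod_univ_six]
  have e : ∀ i, bzNum a i = ((numExp a i : ℕ) : ℤ) := fun i => (Int.toNat_of_nonneg (hA i)).symm
  have f0 : bzDen a 0 = ((gapExp a 0 : ℕ) : ℤ) := (Int.toNat_of_nonneg (hB 0)).symm
  have f1 : bzDen a 1 = ((gapExp a 1 : ℕ) : ℤ) := (Int.toNat_of_nonneg (hB 1)).symm
  have f2 : bzDen a 2 = ((gapExp a 2 : ℕ) : ℤ) := (Int.toNat_of_nonneg (hB 2)).symm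
  have f3 : bzDen a 3 = ((gapExp a 3 : ℕ) : ℤ) := (Int.toNat_of_nonneg (hB 3)).symm
  have f4 : bzDen a 4 = ((gapExp a 4 : ℕ) : ℤ) := (Int.toNat_of_nonneg (hB 4)).symm
  have f5 : bzDen a 5 = ((gapExp a 5 : ℕ) : ℤ) := (Int.toNat_of_nonneg (hB 5)).symm
  rw [e 0, e 1, e 2, e 3, e 6, e 7, f0, f1, f2, f3, f4, f5]
  simp only [zpow_natCast]
  have g0 : gap t 0 = t 0 := by simp [gap, pt]
  have g1 : gap t 1 = t 1 - t 0 := by simp [gap, pt]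
  have g2 : gap t 2 = t 2 - t 1 := by simp [gap, pt]
  have g3 : gap t 3 = t 3 - t 2 := by simp [gap, pt]
  have g4 : gap t 4 = t 4 - t 3 := by simp [gap, pt]
  have g5 : gap t 5 = 1 - t 4 := by simp [gap, pt]
  rw [g0, g1, g2, g3, g4, g5]
  ring_nf

/-! ## A point of the simplex with prescribed gaps -/

/-- The total of six gaps. -/
def gsum (g : Fin 6 → ℝ) : ℝ := g 0 + g 1 + g 2 + g 3 + g 4 + g 5

/-- The point of the simplex whose gaps are `g / Σ g`. -/
def simplexPoint (g : Fin 6 → ℝ) : Fin 5 → ℝ :=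
  ![g 0 / gsum g, (g 0 + g 1) / gsum g, (g 0 + g 1 + g 2) / gsum g, (g 0 + g 1 + g 2 + g 3) / gsum g,
    (g 0 + g 1 + g 2 + g 3 + g 4) / gsum g]

/-- The total is positive for `g > 0`. -/
theorem gsum_pos {g : Fin 6 → ℝ} (hg : ∀ w, 0 < g w) : 0 < gsum g := by
  have h0 := hg 0; have h1 := hg 1; have h2 := hg 2; have h3 := hg 3; have h4 := hg 4; have h5 := hg 5
  unfold gsum; linarith

/-- It lies in the open simplex (`g > 0`). -/
theorem simplexPoint_mem {g : Fin 6 → ℝ} (hg : ∀ w, 0 < g w) : simplexPoint g ∈ openSimplex 5 := by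
  have h0 := hg 0; have h1 := hg 1; have h2 := hg 2; have h3 := hg 3; have h4 := hg 4; have h5 := hg 5
  have hs : 0 < gsum g := gsum_pos hg
  intro k
  fin_cases k
  · simp [pt, simplexPoint]; exact div_pos h0 hs
  · simp [pt, simplexPoint]; rw [div_lt_div_iff_of_pos_right hs]; linarith
  · simp [pt, simplexPoint]; rw [div_lt_div_iff_of_pos_right hs]; linarith
  · simp [pt, simplexPoint]; rw [div_lt_div_iff_of_pos_right hs]; linarith
  · simp [pt, simplexPoint]; rw [div_lt_div_iff_of_pos_right hs]; linarith
  · simp [pt, simplexPoint]; rw [div_lt_one hs]; unfold gsum; linarith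

/-- Its gaps are `g_w / Σ g`. -/
theorem gap_simplexPoint {g : Fin 6 → ℝ} (hg : ∀ w, 0 < g w) (w : Fin 6) :
    gap (simplexPoint g) w = (gsum g)⁻¹ * g w := by
  have hs : gsum g ≠ 0 := (gsum_pos hg).ne'
  fin_cases w
  · simp [gap, pt, simplexPoint]; field_simp
  · simp [gap, pt, simplexPoint]; field_simp; ring
  · simp [gap, pt, simplexPoint]; field_simp; ring
  · simp [gap, pt, simplexPoint]; field_simp; ring
  · simp [gap, pt, simplexPoint]; field_simp; ring
  · simp [gap, pt, simplexPoint]; field_simp; unfold gsum; ring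

/-- `₈π₈` is a permutation. -/
theorem pi8dualInv_injective' : Function.Injective pi8dualInv := by decide

end DualRate

end Summit.KontsevichZagierPeriods.Zeta5Search.Families.Cellular
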